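import Summits.ABC.ABC.Theses.IsogenyGlueCongruence
import Literature.NumberTheory.EllipticCurves.PastenSpectralDegreeIsogenyBoundProofs
import Literature.NumberTheory.Automorphic.ShimuraCurveRibetTakahashiOptimalProofs
import HarnessLib

/-!
# Route `IsogenyGlueCongruence`, crux `MazurKenkuBound` (stmt-ABC-15125) — line `Sketch`: the two
# glue theorems (radius form of the tree reduction; optimal pivot for the Néron-integrality input)

Helpers (`--supports stmt-ABC-15125`) of the line lead's skeleton `Cruxes/MazurKenkuBound/Lines/Sketch.lean`.
The crux `Summit.ABC.ABC.Theses.IsogenyGlueCongruence.MazurKenkuBound` is definitionally the Literature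
fact `PastenShimura2024_minimalDegree_le_163_mul` (Pasten 2024, §3 p. 13). Two sorry-free reductions:

* `pastenShimura_minimalDegree_le_163_mul_of_radius` — the fact from (RADIUS) "two `ℚ`-isogenous
  elliptic curves over `ℚ` are joined by a `ℚ`-isogeny of degree `≤ 163`" and (`hInt`) the integrality
  of rational multipliers `qΛ_f ⊆ Λ_{W'}` into the Néron lattice of a globally minimal parametrised
  `W'` — the argument of the tree's `PastenShimura2024_minimalDegree_le_163_mul_of_mazurKenku` with the
  Mazur–Kenku LIST (`mazurKenku_exists_cyclic_isogeny`: cyclic, degree in Kenku's list) weakened to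
  the radius, which is all the reduction consumes (idea card `radius-barrier-set`).
* `hInt_of_pivot` — `hInt` from (I-ell) "the Néron scaling `q` of an analytic isogeny `z ↦ qz`,
  `q ∈ ℚ`, between GLOBALLY MINIMAL models over `ℚ` is an integer" and (I-opt) Edixhoven 1991,
  Prop. 2 for the strong Weil curve in lattice form (verbatim the hypothesis `hEd` of the tree's
  `exists_optimal_modularParametrizationData_of_edixhoven`), through the global minimal model of
  `E_f = ℂ/Λ_f` (`exists_isGloballyMinimal_latticeEq_rat`; idea card `optimal-pivot-neron-scaling`).

Both hypotheses-as-displayed are the open inputs (stubs of the line); nothing is claimed about them.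

## References

* H. Pasten, *Shimura curves and the abc conjecture*, J. Number Theory 254 (2024) = arXiv:1705.09251,
  §3 p. 13. [PastenShimura2024]
* B. Edixhoven, *On the Manin constants of modular elliptic curves*, Progr. Math. 89 (1991), Prop. 2.
  [EdixhovenManin1991]
* J. H. Silverman, *The Arithmetic of Elliptic Curves*, 2nd ed. (2009), IX.6 Ex. 6.4, VI.4.1.
  [SilvermanAEC2009]
-/

-- `Summit.<Summit>.<Problem>` is the mandated summit-side namespace (CONVENTIONS §2); for the
-- single-conjunct summit `ABC` the two coincide, so the duplicate `ABC.ABC` is deliberate.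
set_option linter.dupNamespace false

noncomputable section

open scoped MatrixGroups ModularForm

open CongruenceSubgroup
open WeierstrassCurve
open Literature.NumberTheory.EllipticCurves
open Literature.NumberTheory.EllipticCurves.ModularForms

namespace Summit.ABC.ABC.Theorems

/-! ### Glue 1: the optimal pivot (`hInt` from I-ell and I-opt) -/

/-- **`hInt` from the optimal pivot.** Granted (I-ell) Néron scaling integrality and (I-opt)
Edixhoven's integrality for the strong Weil curve, every rational multiplier `q` with
`qΛ_f ⊆ Λ_{W'}` into the Néron lattice of a globally minimal parametrised `W'` is an integer: the
global minimal model `W₀` of `E_f` has Néron lattice `q₀Λ_f` with `q₀ ∈ ℚˣ`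
(`exists_isGloballyMinimal_latticeEq_rat`), `q₀ ∈ ℤ` by (I-opt), `(q/q₀)Λ_{W₀} = qΛ_f ⊆ Λ_{W'}` so
`q/q₀ ∈ ℤ` by (I-ell), and `q = (q/q₀) q₀`. (Card `optimal-pivot-neron-scaling`.)
[cite: EdixhovenManin1991, Prop. 2] -/
theorem hInt_of_pivot
    (hEll : ∀ (W₀ W' : WeierstrassCurve ℚ) [W₀.IsElliptic] [W'.IsElliptic] [W₀.IsGloballyMinimal]
      [W'.IsGloballyMinimal] (L₀ L' : PeriodPair),
      IsNeronLatticeOf (W₀.baseChange ℂ) L₀ → IsNeronLatticeOf (W'.baseChange ℂ) L' →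
      ∀ q : ℚ, (∀ z ∈ L₀.lattice, (q : ℂ) * z ∈ L'.lattice) → ∃ k : ℤ, (k : ℚ) = q)
    (hOpt : ∀ {N : ℕ} [NeZero N] {W' : WeierstrassCurve ℚ} [W'.IsElliptic] [W'.IsGloballyMinimal]
      {f : CuspForm (Gamma0 N) 2} {L' : PeriodPair}, IsNewformOf W' f →
      IsNeronLatticeOf (W'.baseChange ℂ) L' → ∀ q : ℚ,
      (∀ z ∈ periodLattice f, (q : ℂ) * z ∈ L'.lattice) →
      (∀ z ∈ L'.lattice, ∃ w ∈ periodLattice f, z = q * w) → ∃ k : ℤ, (k : ℚ) = q) :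
    ∀ {N : ℕ} [NeZero N] {W' : WeierstrassCurve ℚ} [W'.IsElliptic] [W'.IsGloballyMinimal]
      (D' : ModularParametrizationData W' N) (q : ℚ),
      (∀ z ∈ periodLattice D'.f, (q : ℂ) * z ∈ D'.L.lattice) → ∃ k : ℤ, (k : ℚ) = q := by
  intro N _ W' _ _ D' q hq
  obtain ⟨W₀, hW₀, hW₀', L₀, q₀, hf₀, hL₀, hq₀0, hq₀, hq₀'⟩ :=
    D'.exists_isGloballyMinimal_latticeEq_rat
  haveI := hW₀
  haveI := hW₀'
  -- (I-opt): the Manin constant `q₀` of the strong Weil curve is an integer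
  obtain ⟨k₀, hk₀⟩ := hOpt hf₀ hL₀ q₀ hq₀ hq₀'
  -- `α = q / q₀` maps `Λ_{W₀} = q₀ Λ_f` into `Λ_{W'}`
  have hq₀c : (q₀ : ℂ) ≠ 0 := by exact_mod_cast hq₀0
  have hα : ∀ z ∈ L₀.lattice, ((q / q₀ : ℚ) : ℂ) * z ∈ D'.L.lattice := by
    intro z hz
    obtain ⟨w, hw, hzw⟩ := hq₀' z hz
    have key : ((q / q₀ : ℚ) : ℂ) * z = (q : ℂ) * w := by
      rw [hzw, Rat.cast_div]
      field_simp
    rw [key]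
    exact hq w hw
  -- (I-ell): `α ∈ ℤ`
  obtain ⟨m, hm⟩ := hEll W₀ W' L₀ D'.L hL₀ D'.isNeronLattice (q / q₀) hα
  refine ⟨m * k₀, ?_⟩
  push_cast
  rw [hm, hk₀]
  field_simp

/-! ### Glue 2: the crux from the RADIUS and `hInt` -/

/-- **The crux from the radius statement and Néron integrality.** If two `ℚ`-isogenous elliptic
curves over `ℚ` are always joined by a `ℚ`-isogeny of degree `≤ 163` (`hRad`) and rational
multipliers into Néron lattices of globally minimal parametrised curves are integers (`hInt`), then
`PastenShimura2024_minimalDegree_le_163_mul` holds. This is the argument of the tree's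
`PastenShimura2024_minimalDegree_le_163_mul_of_mazurKenku` with the Mazur–Kenku LIST replaced by the
radius: by `PastenShimura2024_minimalDegree_le_163_mul_of` it suffices to find an integer `k` with
`kΛ_f ⊆ Λ_{E'}` and `#ker(z ↦ kz) ≤ 163`; the `ℚ`-model `E_f` of `ℂ/Λ_f` is `ℚ`-isogenous to `W'`,
`hRad` gives `ψ` of degree `≤ 163` between the short models, its rational multiplier `q` has
`qΛ_f ⊆ Λ_{E'}` and `#ker(z ↦ qz) = deg ψ`, and `q ∈ ℤ` by `hInt`.
[cite: PastenShimura2024, §3 p. 13] -/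
theorem pastenShimura_minimalDegree_le_163_mul_of_radius
    (hRad : ∀ (W W' : WeierstrassCurve ℚ) [W.IsElliptic] [W'.IsElliptic], IsIsogenous W W' →
      ∃ φ : Isogeny W W', φ.degree ≤ 163)
    (hInt : ∀ {N : ℕ} [NeZero N] {W' : WeierstrassCurve ℚ} [W'.IsElliptic] [W'.IsGloballyMinimal]
      (D' : ModularParametrizationData W' N) (q : ℚ),
      (∀ z ∈ periodLattice D'.f, (q : ℂ) * z ∈ D'.L.lattice) → ∃ k : ℤ, (k : ℚ) = q) :
    PastenShimura2024_minimalDegree_le_163_mul := by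
  refine PastenShimura2024_minimalDegree_le_163_mul_of fun {N} _ {W'} _ _ D' ↦ ?_
  -- the `ℚ`-model `W₀ = E_f` of `ℂ/Λ_f`, with Néron-type lattice exactly `Λ_f`
  obtain ⟨W₀, hW₀, -, L₀, hL₀, hΛ⟩ := D'.exists_latticeEq_model
  haveI := hW₀
  have hmem : ∀ z, z ∈ L₀.lattice ↔ z ∈ periodLattice D'.f := fun z ↦ by
    rw [← SetLike.mem_coe, hΛ, SetLike.mem_coe]
  -- `W₀ ~ W'` over `ℚ`, along `z ↦ c' z`
  have hc : (D'.c : ℚ) ≠ 0 := by exact_mod_cast D'.maninConstant_ne_zero_holds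
  have hle : ∀ z ∈ L₀.lattice, ((D'.c : ℚ) : ℂ) * z ∈ D'.L.lattice := fun z hz ↦ by
    rw [Rat.cast_intCast]
    exact D'.smul_periodLattice_le z ((hmem z).mp hz)
  have hiso : IsIsogenous W₀ W' :=
    isIsogenous_of_forall_mul_mem_lattice hL₀.1 hL₀.2 D'.isNeronLattice.1 D'.isNeronLattice.2 hc hle
  -- the short models are `E_{Λ_f}`, `E_{Λ_{E'}}` after base change, and are `ℚ`-isogenous
  set C₀ : VariableChange ℚ := ⟨1, -W₀.b₂ / 12, -W₀.a₁ / 2, W₀.a₁ * W₀.b₂ / 24 - W₀.a₃ / 2⟩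
    with hC₀
  set C' : VariableChange ℚ := ⟨1, -W'.b₂ / 12, -W'.a₁ / 2, W'.a₁ * W'.b₂ / 24 - W'.a₃ / 2⟩
    with hC'
  have hE₀ : (C₀ • W₀).baseChange ℂ = L₀.curve := shortModel_baseChange_eq_curve W₀ hL₀
  have hE' : (C' • W').baseChange ℂ = D'.L.curve :=
    shortModel_baseChange_eq_curve W' D'.isNeronLattice
  have h : IsIsogenous (C₀ • W₀) (C' • W') :=
    (isIsogenous_of_smul W₀ C₀).trans' (hiso.trans' (isIsogenous_smul W' C'))
  -- RADIUS: a `ℚ`-isogeny `ψ` of degree `≤ 163`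
  obtain ⟨ψ, h163⟩ := hRad (C₀ • W₀) (C' • W') h
  -- its rational multiplier `q`: `qΛ_f ⊆ Λ_{E'}`, `#ker(z ↦ qz) = deg ψ`
  obtain ⟨q, hq0, hq, hdegq⟩ :=
    degree_eq_natCard_ker_mulQuotientMap_of_baseChange_eq_curve ψ hE₀ hE'
  have hq' : ∀ z ∈ periodLattice D'.f, (q : ℂ) * z ∈ D'.L.lattice := fun z hz ↦
    hq z ((hmem z).mpr hz)
  -- `q = k ∈ ℤ`
  obtain ⟨k, rfl⟩ := hInt D' q hq'
  have hk : ∀ z ∈ periodLattice D'.f, (k : ℂ) * z ∈ D'.L.lattice := fun z hz ↦ by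
    have := hq' z hz
    rwa [Rat.cast_intCast] at this
  refine ⟨k, hk, by exact_mod_cast hq0, ?_⟩
  have hΛ' : L₀.lattice.toAddSubgroup = periodLattice D'.f :=
    SetLike.coe_injective (by rw [Submodule.coe_toAddSubgroup, hΛ])
  have hcast : ((k : ℚ) : ℂ) = (k : ℂ) := Rat.cast_intCast k
  calc Nat.card (mulQuotientMap (periodLattice D'.f) D'.L.lattice.toAddSubgroup (k : ℂ) hk).ker
      = Nat.card (mulQuotientMap L₀.lattice.toAddSubgroup D'.L.lattice.toAddSubgroup
          ((k : ℚ) : ℂ) hq).ker := by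
        simp only [hcast]
        exact (natCard_ker_mulQuotientMap_congr hΛ' rfl (fun z hz ↦ hk z (hΛ' ▸ hz)) hk).symm
    _ = ψ.degree := hdegq.symm
    _ ≤ 163 := h163

end Summit.ABC.ABC.Theorems

end
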